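import Mathlib
import HarnessLib
import Summits.Ventures.LatticeQCDFlow.Scaling.AutoregressiveBlockFaithful

/-!
# LatticeQCDFlow / Scaling — THE CONTEXT OF THE EXACT AUTOREGRESSIVE CONDITIONAL OF A STRICTLY TP₂
# FERROMAGNET IS EXACTLY THE FILL-NEIGHBOURHOOD (both halves of T2-AF's bracket; Gaussian fields)

HONEST FRAMING: exact (Metropolis-corrected) sampling algorithms for lattice gauge theory;
figures of merit are autocorrelation/cost numbers at stated couplings and volumes; no
continuum-physics claim.

Venture `LatticeQCDFlow` (cell pub-lqcd), topic `Scaling`, FANOUT row 30 (lean-1, GEN-17) — OUR WORK for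
THEORY-2 §4 (T2-AF / C5: what an exact autoregressive sampler of a lattice field must represent).  The
bracket: GEN-15 `Scaling/AutoregressiveMarkovContext.arConditional_congr_of_higherAdj` — for ANY weight
factorising over cliques of a graph `G`, the exact conditional of `a` (generation from the top,
`s = {u | u < a}`) reads at most `a` and its higher fill-neighbourhood `adj⁺_{elim G}(a)` — and GEN-17
`Scaling/AutoregressiveBlockFaithful.pairBondWeight_arConditional_reads_higherAdj` — for a pair
interaction whose every `G`-edge carries a strictly TP₂ bond it reads EVERY vertex of `adj⁺(a)`.  Here
the two are put together:

* §1 `pairBondWeight_eq_prod_terms` (the pair-interaction weight as a clique-term product over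
  `V ⊕ E`) and **`pairBondWeight_arConditional_congr_of_higherAdj`** — the upper half specialised to
  pair interactions whose bond terms join `G`-adjacent vertices.
* §1 **`pairBondWeight_arConditional_reads_iff_mem_higherAdj`** — for `v ≠ a`: THE EXACT CONDITIONAL OF
  `a` READS `v` IF AND ONLY IF `v ∈ adj⁺_{elim G}(a)` (positive bounded measurable factors, TP₂ bonds,
  every edge of `G` carrying a strictly TP₂ bond, reference probability measure not a point mass);
  `…_fromRel`: the same for the interaction graph `SimpleGraph.fromRel` of the weight itself when all
  bonds are strictly TP₂ (no edge bookkeeping left); `pairBondWeight_readSet_eq_higherAdj` (set form).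
* §2 **`gaussianField_arConditional_reads_iff_mem_higherAdj`** — THE STANDARD INSTANCE: discrete
  Gaussian / gradient fields `∏_i g_i(x_i)·∏_e exp(−κ_e(x_{src e} − x_{tgt e})²/2)`, `κ_e > 0`, arbitrary
  positive bounded measurable one-body factors (masses, fields, `φ⁴` terms), any reference probability
  measure on `ℝ` charging `(−∞, c)` and `(c, ∞)`: reads `v` iff `v ∈ adj⁺(a)`.

READING (value-free): for these targets the receptive field of an EXACT autoregressive conditioner at
site `a` is a combinatorial invariant of the graph and the order — the fill-neighbourhood of the
elimination game — no smaller context is exact in any dimension, and no larger one is needed.  The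
counting consequences (some site reads ≥ `treewidth G` sites in every order; `≥ c_d·L^{d−1}` on the
torus; minimax over orders = treewidth) are the sequel `Scaling/AutoregressiveContextTreewidth`.  NOT CLAIMED: gauge
theories; TP₂-but-not-strict bonds; any rate or number of ours.  Elementary over the parents; nothing
is cited as a fact; no `def`; no `sorry`.
-/

noncomputable section

namespace Summit.Ventures.LatticeQCDFlow.Theory2.Autoregressive

open MeasureTheory Function Set
open Summit.Ventures.LatticeQCDFlow.Exactness

variable {X : Type*} [LinearOrder X] [MeasurableSpace X]

/-! ## §1 Both halves: the context is exactly the fill-neighbourhood -/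

section Exact

open Literature.Combinatorics.SimpleGraph Literature.LinearAlgebra.Matrix.ChordalSparsity

variable {V : Type*} [Fintype V] [LinearOrder V] [DecidableEq V] (μ : Measure X)
  [IsProbabilityMeasure μ]

omit [LinearOrder X] [MeasurableSpace X] [LinearOrder V] [DecidableEq V] in
/-- The pair-interaction weight as a product of clique terms indexed by `V ⊕ E` (one-body terms and
bond terms), the format of `Scaling/AutoregressiveMarkovContext`. [ours] -/
theorem pairBondWeight_eq_prod_terms {η : Type*} (E : Finset η) (src tgt : η → V)
    (b : η → X → X → ℝ) (g : V → X → ℝ) (x : V → X) :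
    (∏ i, g i (x i)) * ∏ e ∈ E, b e (x (src e)) (x (tgt e)) =
      ∏ t : V ⊕ ↥E,
        Sum.elim (fun (i : V) (η' : V → X) => g i (η' i))
          (fun (e : ↥E) (η' : V → X) => b e (η' (src e)) (η' (tgt e))) t x := by
  rw [Fintype.prod_sum_type]
  congr 1
  exact (Finset.prod_coe_sort E (fun e => b e (x (src e)) (x (tgt e)))).symm

omit [LinearOrder X] in
/-- **UPPER HALF FOR PAIR INTERACTIONS** (GEN-15 `arConditional_congr_of_higherAdj` specialised): if
every bond term of `E` joins two `G`-adjacent (or equal) vertices, positive bounded measurable factors,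
then configurations agreeing at `a` and on `adj⁺_{elim G}(a)` have the same exact conditional of `a`
(generation from the top). [ours] -/
theorem pairBondWeight_arConditional_congr_of_higherAdj {η : Type*} (G : SimpleGraph V)
    (E : Finset η) (src tgt : η → V) (b : η → X → X → ℝ) (g : V → X → ℝ)
    (hgm : ∀ i, Measurable (g i)) (hbm : ∀ e, Measurable (uncurry (b e)))
    (hg0 : ∀ i u, 0 < g i u) (hb0 : ∀ e u v, 0 < b e u v) (hgC : ∀ i, ∃ C, ∀ u, g i u ≤ C)
    (hbC : ∀ e, ∃ C, ∀ u v, b e u v ≤ C)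
    (hEG : ∀ e ∈ E, src e ≠ tgt e → G.Adj (src e) (tgt e)) (a : V) {ω ω' : V → X}
    (ha : ω a = ω' a) (h : ∀ v ∈ higherAdj (elimGraph G).Adj a, ω v = ω' v) :
    let w : (V → X) → ℝ := fun x => (∏ i, g i (x i)) * ∏ e ∈ E, b e (x (src e)) (x (tgt e))
    coordAvg μ (Finset.univ.filter (· < a)) w ω /
        coordAvg μ (insert a (Finset.univ.filter (· < a))) w ω =
      coordAvg μ (Finset.univ.filter (· < a)) w ω' /
        coordAvg μ (insert a (Finset.univ.filter (· < a))) w ω' := by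
  intro w
  have hw : w = fun x => ∏ t : V ⊕ ↥E,
      Sum.elim (fun (i : V) (η' : V → X) => g i (η' i))
        (fun (e : ↥E) (η' : V → X) => b e (η' (src e)) (η' (tgt e))) t x :=
    funext fun x => pairBondWeight_eq_prod_terms E src tgt b g x
  rw [hw]
  refine arConditional_congr_of_higherAdj μ G a _
    (Sum.elim (fun i => ({i} : Finset V)) (fun e : ↥E => ({src e, tgt e} : Finset V)))
    ?_ ?_ ?_ ?_ ?_ ha h
  · rintro (i | e) x y hxy
    · change g i (x i) = g i (y i)
      rw [hxy i (by simp)]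
    · change b e (x (src e)) (x (tgt e)) = b e (y (src e)) (y (tgt e))
      rw [hxy (src e) (by simp), hxy (tgt e) (by simp)]
  · rintro (i | e) j hj k hk hjk
    · change j ∈ ({i} : Finset V) at hj
      change k ∈ ({i} : Finset V) at hk
      rw [Finset.mem_singleton] at hj hk
      exact absurd (hj.trans hk.symm) hjk
    · change j ∈ ({src (e : η), tgt (e : η)} : Finset V) at hj
      change k ∈ ({src (e : η), tgt (e : η)} : Finset V) at hk
      rw [Finset.mem_insert, Finset.mem_singleton] at hj hk
      rcases hj with rfl | rfl <;> rcases hk with rfl | rfl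
      · exact absurd rfl hjk
      · exact hEG e e.2 hjk
      · exact (hEG e e.2 (Ne.symm hjk)).symm
      · exact absurd rfl hjk
  · rintro (i | e)
    · exact (hgm i).comp (measurable_pi_apply i)
    · show Measurable (uncurry (b e) ∘ fun x : V → X => (x (src e), x (tgt e)))
      exact (hbm e).comp ((measurable_pi_apply _).prodMk (measurable_pi_apply _))
  · rintro (i | e) x
    · exact hg0 i _
    · exact hb0 e _ _
  · rintro (i | e)
    · obtain ⟨C, hC⟩ := hgC i; exact ⟨C, fun x => hC _⟩
    · obtain ⟨C, hC⟩ := hbC e; exact ⟨C, fun x => hC _ _⟩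

/-- **THE CONTEXT OF THE EXACT AUTOREGRESSIVE CONDITIONAL OF A STRICTLY TP₂ FERROMAGNET IS EXACTLY THE
FILL-NEIGHBOURHOOD.**  Graph `G`; pair-interaction weight whose bond terms join `G`-adjacent vertices,
every edge of `G` carrying a STRICTLY TP₂ bond; positive bounded measurable factors, TP₂ bonds;
reference probability measure not a point mass; generation from the top (`s = {u | u < a}`).  Then for
every `v ≠ a`: the exact conditional `A_s w / A_{insert a s} w` of `a` READS `v` (two configurations
agreeing off `v` with different conditionals) IF AND ONLY IF `v ∈ adj⁺_{elim G}(a)`, the higher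
neighbourhood of `a` in the elimination (fill) graph.  T2-AF's triangular-footprint bracket
(`AutoregressiveMarkovContext`, upper; `AutoregressiveBlockFaithful`, lower) is an equality. [ours] -/
theorem pairBondWeight_arConditional_reads_iff_mem_higherAdj {η : Type*}
    (hμ : 0 < (μ.prod μ) {p : X × X | p.1 < p.2}) (G : SimpleGraph V) (E : Finset η)
    (src tgt : η → V) (b : η → X → X → ℝ) (g : V → X → ℝ) (hgm : ∀ i, Measurable (g i))
    (hbm : ∀ e, Measurable (uncurry (b e))) (hg0 : ∀ i u, 0 < g i u) (hb0 : ∀ e u v, 0 < b e u v)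
    (hgC : ∀ i, ∃ C, ∀ u, g i u ≤ C) (hbC : ∀ e, ∃ C, ∀ u v, b e u v ≤ C)
    (hb : ∀ e u u' v v', u ≤ u' → v ≤ v' → b e u' v * b e u v' ≤ b e u v * b e u' v')
    (hEG : ∀ e ∈ E, src e ≠ tgt e → G.Adj (src e) (tgt e))
    (hGE : ∀ i k, G.Adj i k → ∃ e ∈ E, ((src e = i ∧ tgt e = k) ∨ (src e = k ∧ tgt e = i)) ∧
        ∀ u u' v v', u < u' → v < v' → b e u' v * b e u v' < b e u v * b e u' v')
    (a : V) {v : V} (hva : v ≠ a) :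
    let w : (V → X) → ℝ := fun x => (∏ i, g i (x i)) * ∏ e ∈ E, b e (x (src e)) (x (tgt e))
    (∃ ψ ψ' : V → X, (∀ i, i ≠ v → ψ i = ψ' i) ∧
      coordAvg μ (Finset.univ.filter (· < a)) w ψ /
          coordAvg μ (insert a (Finset.univ.filter (· < a))) w ψ ≠
        coordAvg μ (Finset.univ.filter (· < a)) w ψ' /
          coordAvg μ (insert a (Finset.univ.filter (· < a))) w ψ') ↔
      v ∈ higherAdj (elimGraph G).Adj a := by
  intro w
  constructor
  · rintro ⟨ψ, ψ', hψ, hne⟩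
    by_contra hv
    exact hne (pairBondWeight_arConditional_congr_of_higherAdj μ G E src tgt b g hgm hbm hg0 hb0 hgC
      hbC hEG a (hψ a (Ne.symm hva)) fun u hu => hψ u fun h => hv (h ▸ hu))
  · intro hv
    exact pairBondWeight_arConditional_reads_higherAdj μ hμ G E src tgt b g hgm hbm hg0 hb0 hgC hbC
      hb hGE a hv

/-- **… FOR THE INTERACTION GRAPH ITSELF**: with ALL bonds strictly TP₂ and
`G = SimpleGraph.fromRel (e ↦ (src e, tgt e))` the interaction graph of the weight, no edge bookkeeping
is left: for every `v ≠ a` the exact conditional of `a` (generation from the top) reads `v` iff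
`v ∈ adj⁺_{elim G}(a)`. [ours] -/
theorem pairBondWeight_arConditional_reads_iff_mem_higherAdj_fromRel {η : Type*}
    (hμ : 0 < (μ.prod μ) {p : X × X | p.1 < p.2}) (E : Finset η) (src tgt : η → V)
    (b : η → X → X → ℝ) (g : V → X → ℝ) (hgm : ∀ i, Measurable (g i))
    (hbm : ∀ e, Measurable (uncurry (b e))) (hg0 : ∀ i u, 0 < g i u) (hb0 : ∀ e u v, 0 < b e u v)
    (hgC : ∀ i, ∃ C, ∀ u, g i u ≤ C) (hbC : ∀ e, ∃ C, ∀ u v, b e u v ≤ C)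
    (hbs : ∀ e u u' v v', u < u' → v < v' → b e u' v * b e u v' < b e u v * b e u' v')
    (hb : ∀ e u u' v v', u ≤ u' → v ≤ v' → b e u' v * b e u v' ≤ b e u v * b e u' v')
    (a : V) {v : V} (hva : v ≠ a) :
    let w : (V → X) → ℝ := fun x => (∏ i, g i (x i)) * ∏ e ∈ E, b e (x (src e)) (x (tgt e))
    let G : SimpleGraph V := SimpleGraph.fromRel fun i k => ∃ e ∈ E, src e = i ∧ tgt e = k
    (∃ ψ ψ' : V → X, (∀ i, i ≠ v → ψ i = ψ' i) ∧
      coordAvg μ (Finset.univ.filter (· < a)) w ψ /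
          coordAvg μ (insert a (Finset.univ.filter (· < a))) w ψ ≠
        coordAvg μ (Finset.univ.filter (· < a)) w ψ' /
          coordAvg μ (insert a (Finset.univ.filter (· < a))) w ψ') ↔
      v ∈ higherAdj (elimGraph G).Adj a := by
  intro w G
  refine pairBondWeight_arConditional_reads_iff_mem_higherAdj μ hμ G E src tgt b g hgm hbm hg0 hb0 hgC
    hbC hb (fun e he hne => ?_) (fun i k hik => ?_) a hva
  · exact (SimpleGraph.fromRel_adj _ _ _).2 ⟨hne, Or.inl ⟨e, he, rfl, rfl⟩⟩
  · obtain ⟨hne, h | h⟩ := (SimpleGraph.fromRel_adj _ _ _).1 hik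
    · obtain ⟨e, he, hs, ht⟩ := h
      exact ⟨e, he, Or.inl ⟨hs, ht⟩, hbs e⟩
    · obtain ⟨e, he, hs, ht⟩ := h
      exact ⟨e, he, Or.inr ⟨hs, ht⟩, hbs e⟩

/-- **THE READ SET IS THE FILL-NEIGHBOURHOOD** (set form of the `iff`): the set of sites `v ≠ a` read
by the exact conditional of `a` equals `adj⁺_{elim G}(a)`. [ours] -/
theorem pairBondWeight_readSet_eq_higherAdj {η : Type*}
    (hμ : 0 < (μ.prod μ) {p : X × X | p.1 < p.2}) (G : SimpleGraph V) (E : Finset η)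
    (src tgt : η → V) (b : η → X → X → ℝ) (g : V → X → ℝ) (hgm : ∀ i, Measurable (g i))
    (hbm : ∀ e, Measurable (uncurry (b e))) (hg0 : ∀ i u, 0 < g i u) (hb0 : ∀ e u v, 0 < b e u v)
    (hgC : ∀ i, ∃ C, ∀ u, g i u ≤ C) (hbC : ∀ e, ∃ C, ∀ u v, b e u v ≤ C)
    (hb : ∀ e u u' v v', u ≤ u' → v ≤ v' → b e u' v * b e u v' ≤ b e u v * b e u' v')
    (hEG : ∀ e ∈ E, src e ≠ tgt e → G.Adj (src e) (tgt e))
    (hGE : ∀ i k, G.Adj i k → ∃ e ∈ E, ((src e = i ∧ tgt e = k) ∨ (src e = k ∧ tgt e = i)) ∧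
        ∀ u u' v v', u < u' → v < v' → b e u' v * b e u v' < b e u v * b e u' v') (a : V) :
    let w : (V → X) → ℝ := fun x => (∏ i, g i (x i)) * ∏ e ∈ E, b e (x (src e)) (x (tgt e))
    {v : V | v ≠ a ∧ ∃ ψ ψ' : V → X, (∀ i, i ≠ v → ψ i = ψ' i) ∧
      coordAvg μ (Finset.univ.filter (· < a)) w ψ /
          coordAvg μ (insert a (Finset.univ.filter (· < a))) w ψ ≠
        coordAvg μ (Finset.univ.filter (· < a)) w ψ' /
          coordAvg μ (insert a (Finset.univ.filter (· < a))) w ψ'} =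
      higherAdj (elimGraph G).Adj a := by
  intro w
  ext v
  constructor
  · rintro ⟨hva, h⟩
    exact (pairBondWeight_arConditional_reads_iff_mem_higherAdj μ hμ G E src tgt b g hgm hbm hg0 hb0
      hgC hbC hb hEG hGE a hva).1 h
  · intro hv
    have hva : v ≠ a := by
      rintro rfl
      exact lt_irrefl _ (mem_higherAdj_iff.1 hv).1
    exact ⟨hva, (pairBondWeight_arConditional_reads_iff_mem_higherAdj μ hμ G E src tgt b g hgm hbm
      hg0 hb0 hgC hbC hb hEG hGE a hva).2 hv⟩

end Exact

/-! ## §2 The standard instance: Gaussian / gradient fields on any graph -/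

section Gaussian

open Literature.Combinatorics.SimpleGraph Literature.LinearAlgebra.Matrix.ChordalSparsity

variable {V : Type*} [Fintype V] [LinearOrder V] [DecidableEq V]

/-- **DISCRETE GAUSSIAN / GRADIENT FIELDS ON ANY GRAPH: THE CONTEXT OF THE EXACT AUTOREGRESSIVE
CONDITIONAL IS EXACTLY THE FILL-NEIGHBOURHOOD.**  Weight
`w(x) = ∏_i g_i(x_i) · ∏_{e ∈ E} exp(−κ_e (x_{src e} − x_{tgt e})²/2)` on `V → ℝ` with `κ_e > 0`, the
bond terms joining `G`-adjacent vertices and every edge of `G` carrying one, arbitrary positive bounded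
measurable one-body factors `g_i` (masses, external fields, `φ⁴` terms …), any reference probability
measure `ν` on `ℝ` charging both `(−∞, c)` and `(c, ∞)` for some `c`; generation from the top.  Then for
every `v ≠ a` the exact conditional of `a` reads `v` iff `v ∈ adj⁺_{elim G}(a)`. [ours] -/
theorem gaussianField_arConditional_reads_iff_mem_higherAdj {η : Type*} (ν : Measure ℝ)
    [IsProbabilityMeasure ν] (c : ℝ) (h₁ : ν (Iio c) ≠ 0) (h₂ : ν (Ioi c) ≠ 0) (G : SimpleGraph V)
    (E : Finset η) (src tgt : η → V) (κ : η → ℝ) (hκ : ∀ e, 0 < κ e) (g : V → ℝ → ℝ)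
    (hgm : ∀ i, Measurable (g i)) (hg0 : ∀ i u, 0 < g i u) (hgC : ∀ i, ∃ C, ∀ u, g i u ≤ C)
    (hEG : ∀ e ∈ E, src e ≠ tgt e → G.Adj (src e) (tgt e))
    (hGE : ∀ i k, G.Adj i k → ∃ e ∈ E, (src e = i ∧ tgt e = k) ∨ (src e = k ∧ tgt e = i))
    (a : V) {v : V} (hva : v ≠ a) :
    let w : (V → ℝ) → ℝ := fun x =>
      (∏ i, g i (x i)) * ∏ e ∈ E, Real.exp (-(κ e * (x (src e) - x (tgt e)) ^ 2 / 2))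
    (∃ ψ ψ' : V → ℝ, (∀ i, i ≠ v → ψ i = ψ' i) ∧
      coordAvg ν (Finset.univ.filter (· < a)) w ψ /
          coordAvg ν (insert a (Finset.univ.filter (· < a))) w ψ ≠
        coordAvg ν (Finset.univ.filter (· < a)) w ψ' /
          coordAvg ν (insert a (Finset.univ.filter (· < a))) w ψ') ↔
      v ∈ higherAdj (elimGraph G).Adj a :=
  pairBondWeight_arConditional_reads_iff_mem_higherAdj ν (real_prod_lt_pos ν c h₁ h₂) G E src tgt
    (fun e u x => Real.exp (-(κ e * (u - x) ^ 2 / 2))) g hgm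
    (fun e => (gaussianBond_props (κ e) (hκ e).le).2.1) hg0
    (fun e u x => (gaussianBond_props (κ e) (hκ e).le).1 u x) hgC
    (fun e => ⟨1, fun u x => (abs_le.1 ((gaussianBond_props (κ e) (hκ e).le).2.2 u x)).2⟩)
    (fun e u u' x y hu hxy => gaussianBond_tp2 (hκ e).le u u' x y hu hxy) hEG
    (fun i k hik => (hGE i k hik).imp fun e he => ⟨he.1, he.2, fun u u' x y hu hxy =>
      (mul_comm _ _).trans_lt (gaussianBond_stp2 (hκ e) u u' x y hu hxy)⟩) a hva

end Gaussian

end Summit.Ventures.LatticeQCDFlow.Theory2.Autoregressive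

end
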